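import Summits.QuantumFields.BalabanUV.T4Continuum.Support.RegionCornerCouplingSupport
import Summits.QuantumFields.BalabanUV.T4Continuum.Support.RegionGaugeResolventSplit

/-!
# T⁴ programme, spine node NE2 (U1a), sub-row Δ1 «NE2⁰-Dirichlet» — THE LOCAL OPERATOR `Δ_loc` ON AN ARBITRARY UNION OF BLOCKS:
# `Δ_loc = Σ_μ W_μ + C + a n^d·avgRᴴavgR`, componentwise on corner-free fields, and the two-level pairing SPLIT into its componentwise part
# and a CORNER PAIRING that reads corner restrictions only

NE2 formalisation swarm `b2b-balaban-t4-ne2-formalise-*`, LEAF PROVER 02 (gen 9), support item «Δ1-CORNER-COUPLING», file 4 (files 1–3: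
`Support/RegionExteriorFlux`, `Support/RegionCornerCoupling`, `Support/RegionCornerCouplingSupport`).  The row-NE2 owner's box END
(`RegionLocalInjectedAssembly.hloc_of_WPairing`, p239590) consumes ONE displayed Gaffney pairing (P-W) of the mass-free local operator
`regionDeltaLoc n M 0 S` across two levels; on boxes that operator is `Σ_μ W_μ` (gen 8's `electric_splitting`).  On the re-entrant front (ruling
R37 (e)) it is `Σ_μ W_μ + C`; THIS FILE writes the consequences of files 1–3 in the owner's currency, for EVERY union of blocks:

 * §1 **`regionDeltaLoc_eq_general`** `Δ_loc(a) = Σ_μ W_μ + C + (a n^d)•avgRᴴavgR` and `regionDeltaLoc_zero_eq_general`; at `2 ≤ n`,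
   **`regionDeltaLoc_mulVec_of_vanish_corner`**: on fields vanishing on the corner bonds `Δ_loc` acts COMPONENTWISE (`C v = 0`, file 3).
 * §2 the two-level pairing of the mass-free local operators through ANY `J` SPLITS (`loc_pairing_split`):
   `⟨v, (J·Δ_loc − Δ′_loc·J)u⟩ = Σ_μ ⟨v, (J·W_μ − W′_μ·J)u⟩ + ⟨v, (J·C − C′·J)u⟩`, and at `2 ≤ n, 2 ≤ n′` the CORNER PAIRING reads corner
   restrictions only (**`corner_pairing_eq_proj`**): `⟨v, (J·C − C′·J)u⟩ = ⟨P(Jᴴv), C(Pu)⟩ − ⟨P′v, C′(P′(Ju))⟩` — the located NEW term of the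
   (P-W) socket on re-entrant regions (its size is NOT estimated here: the crude bound `‖C‖·‖Pu‖·‖P(Jᴴv)‖` does not decay, cancellation between
   the two levels is what a re-entrant (P-W) has to supply — prose).

HONEST FRAMING (T4-DAG p. 1).  Lattice bookkeeping at MODEL level (`U = 1`, ONE region, finite torus); statements OURS ([folklore]); identities and
the support statement only — no pairing ESTIMATE, no Hessian budget, no W2, no tower on re-entrant regions is claimed; W3 on boxes OPEN; Δ1 NOT
closed; NE2 (U1a) NOT proved; spine PROVED 0/9 unchanged; NOT [B9] (3.16)/(3.23)–(3.27) as printed; NOT infinite volume, NOT a mass gap, NOT the Clay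
problem.  HONEST DEPENDENCY: continuum YM on T⁴ ⇐ BetaPertH ∧ nine spine estimates (0/9 proved); BetaPertH ⇐ (D1) ∧ (D4) ∧ CAP+tail; G-an2-4
gates asym, D1 and NE2/3/4.  No `sorry`.
-/

noncomputable section

open scoped BigOperators ComplexConjugate Matrix Matrix.Norms.L2Operator
open Finset

namespace Summit.QuantumFields.BalabanUV.T4Continuum.RegionLocalCornerSplit

open Literature.MathematicalPhysics.QuantumFieldTheory.Balaban1983to89.B5Prop11Plancherel (Tor fine)
open Summit.QuantumFields.BalabanUV.T4Continuum
open Summit.QuantumFields.BalabanUV.T4Continuum.RegionGaugeFixedVector (starReg curlR gradR avgR)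
open Summit.QuantumFields.BalabanUV.T4Continuum.RegionElectricSplitting (Wdir)
open Summit.QuantumFields.BalabanUV.T4Continuum.RegionElectricGeneral (cornerC cornerC_isHermitian electric_general)
open Summit.QuantumFields.BalabanUV.T4Continuum.RegionCornerCoupling (cornerWt)
open Summit.QuantumFields.BalabanUV.T4Continuum.RegionCornerCouplingSupport (cornerP cornerC_mulVec_eq_zero_of_vanish
  cornerC_mulVec_eq_mulVec_proj cornerP_mulVec_cornerC_mulVec)
open Summit.QuantumFields.BalabanUV.T4Continuum.RegionGaugeResolventSplit (regionDeltaLoc regionDeltaLoc_eq)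

variable {d : ℕ}

section Region

variable (n : ℕ) [NeZero n] (M : Fin d → ℕ) [hM : ∀ μ, NeZero (M μ)] (S : Tor M → Prop) [DecidablePred S] (a : ℝ)

/-! ## §1 The local operator on any union of blocks -/

/-- **`Δ_loc(a) = Σ_μ W_μ + C + (a n^d)•avgRᴴavgR`** on EVERY union of blocks (`regionDeltaLoc_eq` + file 6's `electric_general`). [folklore] -/
theorem regionDeltaLoc_eq_general :
    regionDeltaLoc n M a S
      = (∑ μ, Wdir n M S μ + cornerC n M S) + ((a * (n : ℝ) ^ d : ℝ) : ℂ) • ((avgR n M S)ᴴ * avgR n M S) := by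
  rw [regionDeltaLoc_eq, electric_general]

/-- the mass-free local operator: `Δ_loc(0) = Σ_μ W_μ + C`. [folklore] -/
theorem regionDeltaLoc_zero_eq_general : regionDeltaLoc n M 0 S = ∑ μ, Wdir n M S μ + cornerC n M S := by
  rw [regionDeltaLoc_eq_general, zero_mul, Complex.ofReal_zero, zero_smul, add_zero]

/-- **ON CORNER-FREE FIELDS `Δ_loc` IS COMPONENTWISE** (`2 ≤ n`): if `v` vanishes on the corner bonds then
`Δ_loc(a) v = (Σ_μ W_μ + (a n^d)•avgRᴴavgR) v`. [folklore] -/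
theorem regionDeltaLoc_mulVec_of_vanish_corner (hn : 2 ≤ n) {v : {b // starReg n M S b} → ℂ}
    (hv : ∀ y, cornerWt n M S y.1 ≠ 0 → v y = 0) :
    regionDeltaLoc n M a S *ᵥ v = (∑ μ, Wdir n M S μ + ((a * (n : ℝ) ^ d : ℝ) : ℂ) • ((avgR n M S)ᴴ * avgR n M S)) *ᵥ v := by
  rw [regionDeltaLoc_eq_general, Matrix.add_mulVec, Matrix.add_mulVec, cornerC_mulVec_eq_zero_of_vanish n M S hn hv, add_zero,
    Matrix.add_mulVec]

/-! ## §2 The two-level pairing splits; the corner pairing reads corner restrictions only -/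

variable (n' : ℕ) [NeZero n']

/-- **THE PAIRING SPLIT** (any two levels, any `J`): `⟨v, (J·Δ_loc(0) − Δ′_loc(0)·J)u⟩ = Σ_μ ⟨v, (J·W_μ − W′_μ·J)u⟩ + ⟨v, (J·C − C′·J)u⟩`.
[folklore] -/
theorem loc_pairing_split (J : Matrix {b // starReg n' M S b} {b // starReg n M S b} ℂ)
    (u : {b // starReg n M S b} → ℂ) (v : {b // starReg n' M S b} → ℂ) :
    star v ⬝ᵥ ((J * regionDeltaLoc n M 0 S - regionDeltaLoc n' M 0 S * J) *ᵥ u)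
      = ∑ μ, star v ⬝ᵥ ((J * Wdir n M S μ - Wdir n' M S μ * J) *ᵥ u)
        + star v ⬝ᵥ ((J * cornerC n M S - cornerC n' M S * J) *ᵥ u) := by
  rw [regionDeltaLoc_zero_eq_general, regionDeltaLoc_zero_eq_general, Matrix.mul_add, Matrix.add_mul, Matrix.mul_sum, Matrix.sum_mul]
  have e : J * cornerC n M S - cornerC n' M S * J + (∑ μ, J * Wdir n M S μ - ∑ μ, Wdir n' M S μ * J)
      = ∑ μ, J * Wdir n M S μ + J * cornerC n M S - (∑ μ, Wdir n' M S μ * J + cornerC n' M S * J) := by abel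
  rw [← e, Matrix.add_mulVec, dotProduct_add, ← sum_sub_distrib, Matrix.sum_mulVec, dotProduct_sum, add_comm]

/-- **THE CORNER PAIRING READS CORNER RESTRICTIONS ONLY** (`2 ≤ n`, `2 ≤ n′`):
`⟨v, (J·C − C′·J)u⟩ = ⟨P(Jᴴv), C(Pu)⟩ − ⟨P′v, C′(P′(Ju))⟩`, `P = diag(cornerWt)` at each level. [folklore] -/
theorem corner_pairing_eq_proj (hn : 2 ≤ n) (hn' : 2 ≤ n') (J : Matrix {b // starReg n' M S b} {b // starReg n M S b} ℂ)
    (u : {b // starReg n M S b} → ℂ) (v : {b // starReg n' M S b} → ℂ) :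
    star v ⬝ᵥ ((J * cornerC n M S - cornerC n' M S * J) *ᵥ u)
      = star (cornerP n M S *ᵥ (Jᴴ *ᵥ v)) ⬝ᵥ (cornerC n M S *ᵥ (cornerP n M S *ᵥ u))
        - star (cornerP n' M S *ᵥ v) ⬝ᵥ (cornerC n' M S *ᵥ (cornerP n' M S *ᵥ (J *ᵥ u))) := by
  have hP : ∀ (m : ℕ) [NeZero m], (cornerP m M S).IsHermitian := fun m _ =>
    Matrix.isHermitian_diagonal_iff.mpr fun y => by simp [isSelfAdjoint_iff]
  rw [Matrix.sub_mulVec, dotProduct_sub, ← Matrix.mulVec_mulVec, ← Matrix.mulVec_mulVec]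
  congr 1
  · -- `⟨v, J (C u)⟩ = ⟨Jᴴ v, C u⟩ = ⟨Jᴴv, P (C (P u))⟩ = ⟨P (Jᴴ v), C (P u)⟩`
    rw [← cornerC_mulVec_eq_mulVec_proj n M S hn u]
    conv_rhs => rw [← cornerP_mulVec_cornerC_mulVec n M S hn u, Matrix.star_mulVec, ← Matrix.dotProduct_mulVec, (hP n).eq,
      Matrix.mulVec_mulVec, Matrix.star_mulVec, ← Matrix.dotProduct_mulVec, Matrix.conjTranspose_conjTranspose, Matrix.mulVec_mulVec]
    rw [← Matrix.mulVec_mulVec, ← Matrix.mulVec_mulVec, cornerP_mulVec_cornerC_mulVec n M S hn,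
      cornerP_mulVec_cornerC_mulVec n M S hn]
  · rw [← cornerC_mulVec_eq_mulVec_proj n' M S hn' (J *ᵥ u)]
    conv_rhs => rw [← cornerP_mulVec_cornerC_mulVec n' M S hn' (J *ᵥ u), Matrix.star_mulVec, ← Matrix.dotProduct_mulVec, (hP n').eq,
      Matrix.mulVec_mulVec]
    rw [← Matrix.mulVec_mulVec, cornerP_mulVec_cornerC_mulVec n' M S hn', cornerP_mulVec_cornerC_mulVec n' M S hn']

end Region

end Summit.QuantumFields.BalabanUV.T4Continuum.RegionLocalCornerSplit

end
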